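import Summits.QuantumFields.YangMills.Theorems.ColdStartUniversalityNeutralColdStartMixingEvenValleyMixing
import Summits.QuantumFields.YangMills.Theorems.ColdStartUniversalityLatticeLangevinLawAbsCont
import HarnessLib

/-!
# Route `ColdStartUniversality`, crux K_A1|Γ `NeutralColdStartMixing` (stmt-QuantumFields-27363), LINE 7
# «valley_averaging»: RE-TYPING STUB 2 ALONE TO THE VALLEY MODULO THE CENTRE SUFFICES —
# `AdiabaticValleyTracking → ValleyCesaroMixing[θ ↦ |θ|] → NeutralColdStartMixing`

Helper file (seat `ym-line-csu-p1`, g14; `--supports stmt-QuantumFields-27363`).  Completes the custody analysis of LINE 7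
(`…ValleyChargedSector` p720043: stub 2 as typed carries the charged sector; `…EvenValleyMixing` p720334 and `…AbsValley`
p720869: two re-typed compositions; `…ValleyRetypingsWeaker` p721276: the re-typings are weakenings).  Here the cleanest
option is kernel-checked: keep stub 1 (item 27403) AS TYPED and re-type ONLY stub 2 (item 27404) by the textual
substitution `θ_K ↦ |θ_K|` (test functions measurable for the valley MODULO THE CENTRE).  The extra ingredient over the
registered composition is measure theory:

* `ae_eq_comp_abs_of_flip_invariant` — on `Fin n → ℝ` with a measure invariant under the coordinate sign flips, a
  function a.e.-invariant under each flip is a.e. a function of the componentwise absolute value [folklore];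
* inside ★ `neutralColdStartMixing_of_tracking_of_absValleyMixing`: the valley projection `E_Gibbs[g_os | σ(θ_K)]` of a
  centre-even string is (Doob–Dynkin, Mathlib `StronglyMeasurable.exists_eq_measurable_comp`) `φ ∘ θ_K` with `φ` a.e.
  flip-invariant for the law of `θ_K` (twist invariance, p720334), hence a.e. equal to the `σ(|θ_K|)`-measurable
  `(φ ∘ |·|) ∘ θ_K`; the a.e. equality is transported along the cold-start flow by `stub_langevinLawAbsCont` (law of
  `U_s`, `s > 0`, is absolutely continuous; p681022) and `fieldMeasure ≪ gibbsMeasure` (positive Boltzmann weight).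

THEOREMS ONLY; custody information for the planner / critic (NET RECOMMENDATION: re-type item 27404 with `θ_K ↦ |θ_K|`,
nothing else changes); no crux, rung or summit statement is proved here and the Yang–Mills mass gap is NOT proved.
-/

set_option autoImplicit false

noncomputable section

namespace Summit.QuantumFields.YangMills.Theorems.ColdStartUniversality

open MeasureTheory Filter
open scoped NNReal
open Literature.MathematicalPhysics.QuantumFieldTheory
open Literature.MathematicalPhysics.QuantumLattice (fundamentalRep continuous_fundamentalRep)
open Literature.MathematicalPhysics.QuantumFieldTheory.Balaban1983to89
open Literature.MathematicalPhysics.QuantumFieldTheory.Balaban1983to89.T3ContinuumYM3Torus (negOne₂ negOne₂_comm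
  negOne₂_mul_self reTr_negOne₂_mul)

/-! ## §1 Flip-invariant functions are a.e. functions of the componentwise absolute value -/

/-- **A function a.e.-invariant under every coordinate sign flip is a.e. a function of `(|v_j|)_j`**, for any measure on
`Fin n → ℝ` that the flips preserve (induction over finite sets of flipped coordinates; on each sign orthant `|v|` is one
such composite flip). [folklore] -/
theorem ae_eq_comp_abs_of_flip_invariant {n : ℕ} {ν : Measure (Fin n → ℝ)}
    (hF : ∀ i : Fin n, MeasurePreserving (fun v : Fin n → ℝ => fun j => if j = i then -v j else v j) ν ν)
    {φ : (Fin n → ℝ) → ℝ}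
    (hφ : ∀ i : Fin n, (fun v : Fin n → ℝ => φ (fun j => if j = i then -v j else v j)) =ᵐ[ν] φ) :
    (fun v : Fin n → ℝ => φ (fun j => |v j|)) =ᵐ[ν] φ := by
  classical
  -- flips of finite sets of coordinates: measure preserving and fixing `φ` a.e.
  have hS : ∀ S : Finset (Fin n),
      MeasurePreserving (fun v : Fin n → ℝ => fun j => if j ∈ S then -v j else v j) ν ν ∧
      (fun v : Fin n → ℝ => φ (fun j => if j ∈ S then -v j else v j)) =ᵐ[ν] φ := by
    intro S
    induction S using Finset.induction_on with
    | empty =>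
      simp only [Finset.notMem_empty, if_false]
      exact ⟨MeasurePreserving.id ν, EventuallyEq.rfl⟩
    | @insert i S hi ih =>
      obtain ⟨hSmp, hSae⟩ := ih
      have hcomp : (fun v : Fin n → ℝ => fun j => if j ∈ insert i S then -v j else v j) =
          (fun v : Fin n → ℝ => fun j => if j = i then -v j else v j) ∘
            (fun v : Fin n → ℝ => fun j => if j ∈ S then -v j else v j) := by
        funext v j
        simp only [Function.comp_apply, Finset.mem_insert]
        by_cases hji : j = i
        · subst hji
          simp [hi]
        · simp [hji]
      refine ⟨by rw [hcomp]; exact (hF i).comp hSmp, ?_⟩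
      have h1 : ((fun v : Fin n → ℝ => φ (fun j => if j = i then -v j else v j)) ∘
          (fun v : Fin n → ℝ => fun j => if j ∈ S then -v j else v j)) =ᵐ[ν]
          (φ ∘ (fun v : Fin n → ℝ => fun j => if j ∈ S then -v j else v j)) :=
        ae_eq_comp' hSmp.measurable.aemeasurable (hφ i) (Measure.absolutelyContinuous_of_eq hSmp.map_eq)
      have h2 : (fun v : Fin n → ℝ => φ (fun j => if j ∈ insert i S then -v j else v j)) =
          ((fun v : Fin n → ℝ => φ (fun j => if j = i then -v j else v j)) ∘
            (fun v : Fin n → ℝ => fun j => if j ∈ S then -v j else v j)) := by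
        have := congrArg (fun (G : (Fin n → ℝ) → (Fin n → ℝ)) => φ ∘ G) hcomp
        simpa only [Function.comp_def] using this
      rw [h2]
      exact h1.trans hSae
  have hall : ∀ᵐ v ∂ν, ∀ S : Finset (Fin n), φ (fun j => if j ∈ S then -v j else v j) = φ v :=
    ae_all_iff.2 fun S => (hS S).2
  filter_upwards [hall] with v hv
  have key : (fun j => |v j|) = fun j => if j ∈ (Finset.univ.filter fun j => v j < 0) then -v j else v j := by
    funext j
    by_cases hj : v j < 0
    · simp [hj, abs_of_neg hj]
    · simp [hj, abs_of_nonneg (not_lt.mp hj)]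
  rw [key]
  exact hv _

/-- **Product Haar measure is absolutely continuous w.r.t. the Gibbs measure** (the Boltzmann weight is positive).
[folklore] -/
theorem fieldMeasure_absolutelyContinuous_gibbsMeasure {G : Type*} [GaugeGroup G] [MeasurableSpace G]
    [RegularGaugeGroup G] [HaarData G] (P : Params) (β : ℝ) :
    fieldMeasure P 0 G ≪ T4GenFunBounds.gibbsMeasure (G := G) P β := by
  have h1 : fieldMeasure P 0 G ≪ (fieldMeasure P 0 G).withDensity fun U => ENNReal.ofReal (Missing.boltzmann P β U) :=
    withDensity_absolutelyContinuous' (T4GenFunBounds.measurable_ofReal_boltzmann P β).aemeasurable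
      (ae_of_all _ fun U => (ENNReal.ofReal_pos.2 (Missing.boltzmann_pos P β U)).ne')
  have hc : (ENNReal.ofReal (Missing.partitionFn (G := G) P β))⁻¹ ≠ 0 := ENNReal.inv_ne_zero.2 ENNReal.ofReal_ne_top
  intro s hs
  rw [T4GenFunBounds.gibbsMeasure, Measure.smul_apply, smul_eq_mul, mul_eq_zero] at hs
  exact h1 (hs.resolve_left hc)

/-! ## §2 The composition with stub 1 as typed and stub 2 modulo the centre -/

/-- ★★ **K_A1|Γ FROM STUB 1 AS TYPED AND STUB 2 RE-TYPED MODULO THE CENTRE.**  `AdiabaticValleyTracking` (item 27403,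
unchanged) and `ValleyCesaroMixing` with the single textual substitution `θ_K ↦ |θ_K|` (test functions measurable for the
valley modulo the centre) imply `NeutralColdStartMixing`.  [cite: tHooft1979Flux, §2] -/
theorem neutralColdStartMixing_of_tracking_of_absValleyMixing
    (h1 : Summit.QuantumFields.YangMills.Theses.ColdStartUniversality.AdiabaticValleyTracking)
    (h2 : ∃ γ₁ : ℝ, 0 < γ₁ ∧ ∀ (F : Literature.MathematicalPhysics.QuantumFieldTheory.Balaban1983to89.T3ContinuumYM3Torus.T3Family) (γ : ℝ), 0 < γ → γ ≤ γ₁ → ∀ (δ : ℝ), 0 < δ → ∃ T₀ : ℝ, 0 < T₀ ∧ ∃ K₀ : ℕ, ∀ K : ℕ, K₀ ≤ K → ∀ (h : Literature.MathematicalPhysics.QuantumFieldTheory.Balaban1983to89.GaugeField (F.P K) 0 (Matrix.specialUnitaryGroup (Fin 2) ℂ) → ℝ), @MeasureTheory.StronglyMeasurable _ _ _ (MeasurableSpace.comap (fun (V : Literature.MathematicalPhysics.QuantumFieldTheory.Balaban1983to89.GaugeField (F.P K) 0 (Matrix.specialUnitaryGroup (Fin 2) ℂ)) (μ : Fin 3)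 => |(Fintype.card F.USite : ℝ)⁻¹ * ∑ x : F.USite, F.avgObs (Literature.MathematicalPhysics.QuantumFieldTheory.Balaban1983to89.ExpMeanLog.expMeanLogSU : Literature.MathematicalPhysics.QuantumFieldTheory.Balaban1983to89.LoopAverage (Matrix.specialUnitaryGroup (Fin 2) ℂ)) K (Literature.MathematicalPhysics.QuantumFieldTheory.Balaban1983to89.T3ContinuumYM3Torus.ULoop3.polyakov μ x) V|) MeasurableSpace.pi) h → (∀ᵐ V ∂(Literature.MathematicalPhysics.QuantumFieldTheory.Balaban1983to89.T4GenFunBounds.gibbsMeasure (G := Matrix.specialUnitaryGroup (Fin 2) ℂ) (F.P K) ((F.scheme (Literature.MathematicalPhysics.QuantumFieldTheory.Balaban1983to89.ExpMeanLog.expMeanLogSU : Literature.MathematicalPhysics.QuantumFieldTheory.Balaban1983to89.LoopAverage (Matrix.specialUnitaryGroup (Fin 2) ℂ)) γ).β K)), |h V| ≤ 1) → ∀ (Ω : Type) (mΩ : MeasurableSpace Ω) (P : MeasureTheory.Measure Ω) (hP : MeasureTheory.IsProbabilityMeasure P) (W : NNReal → Ω → (Literature.MathematicalPhysics.QuantumFieldTheory.Edge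 3 ((F.P K).sitesPerDir 0) × Literature.MathematicalPhysics.QuantumFieldTheory.NoiseIdx 2 → ℝ)) (hW : Literature.MathematicalPhysics.QuantumFieldTheory.IsFlatBrownian W P) (U : NNReal → Ω → Literature.MathematicalPhysics.QuantumFieldTheory.GaugeConfig 3 ((F.P K).sitesPerDir 0) (Matrix.specialUnitaryGroup (Fin 2) ℂ)), (∀ ω, U 0 ω = fun _ => 1) → (Literature.MathematicalPhysics.QuantumFieldTheory.latticeLangevinDynamics (⟨2, Literature.MathematicalPhysics.QuantumLattice.fundamentalRep (Fin 2), Literature.MathematicalPhysics.QuantumLattice.continuous_fundamentalRep _, Literature.MathematicalPhysics.QuantumLattice.fundamentalRep_injective _, Literature.MathematicalPhysics.QuantumLattice.fundamentalRep_mem_unitaryGroup⟩ : Literature.MathematicalPhysics.QuantumFieldTheory.LatticeRep (Matrix.specialUnitaryGroup (Fin 2) ℂ)) ((γ * (F.P K).eps)⁻¹ / 2)).IsSolution (Literature.MathematicalPhysics.QuantumLattice.fundamentalRep (Fin 2)) hW.natFiltration P W U → ∀ (T : ℝ), T₀ ≤ T → |∫ V, h V ∂(Literature.MathematicalPhysics.QuantumFieldTheory.Balaban1983to89.T4GenFunBounds.gibbsMeasure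 (G := Matrix.specialUnitaryGroup (Fin 2) ℂ) (F.P K) ((F.scheme (Literature.MathematicalPhysics.QuantumFieldTheory.Balaban1983to89.ExpMeanLog.expMeanLogSU : Literature.MathematicalPhysics.QuantumFieldTheory.Balaban1983to89.LoopAverage (Matrix.specialUnitaryGroup (Fin 2) ℂ)) γ).β K)) - T⁻¹ * intervalIntegral (fun s : ℝ => MeasureTheory.integral P (fun ω => h (fun b : Literature.MathematicalPhysics.QuantumFieldTheory.Balaban1983to89.PBond (F.P K) 0 => U (s / (F.P K).eps).toNNReal ω (b.src, b.dir)))) 0 T MeasureTheory.volume| ≤ δ) :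
    Summit.QuantumFields.YangMills.Theses.ColdStartUniversality.NeutralColdStartMixing := by
  obtain ⟨γa, hγa, ha⟩ := h1
  obtain ⟨γb, hγb, hb⟩ := h2
  refine ⟨min γa γb, lt_min hγa hγb, fun F γ hγ hγle os hos δ hδ => ?_⟩
  obtain ⟨c, hc, K₁, hK₁⟩ := ha F γ hγ (hγle.trans (min_le_left _ _)) os hos (δ / 3) (by positivity)
  obtain ⟨T₀, hT₀, K₂, hK₂⟩ := hb F γ hγ (hγle.trans (min_le_right _ _)) (δ / 3) (by positivity)
  set T : ℝ := max T₀ (3 * c / δ + 1) with hT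
  have hTpos : 0 < T := lt_max_of_lt_left hT₀
  have hT₀le : T₀ ≤ T := le_max_left _ _
  have hcT : c / T ≤ δ / 3 := by
    have h3 : 3 * c / δ + 1 ≤ T := le_max_right _ _
    rw [div_le_iff₀ hTpos]
    calc c = δ / 3 * (3 * c / δ) := by field_simp
      _ ≤ δ / 3 * (3 * c / δ + 1) := by gcongr; linarith
      _ ≤ δ / 3 * T := by gcongr
  refine ⟨T, hTpos, max K₁ K₂, fun K hK Ω mΩ P hP W hW U hU0 hUsol => ?_⟩
  -- the level-K objects
  set ℰ : LoopAverage (Matrix.specialUnitaryGroup (Fin 2) ℂ) := ExpMeanLog.expMeanLogSU with hℰ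
  set μ0 := T4GenFunBounds.gibbsMeasure (G := Matrix.specialUnitaryGroup (Fin 2) ℂ) (F.P K) ((F.scheme ℰ γ).β K) with hμ0
  have hβK : 0 ≤ (F.scheme ℰ γ).β K := F.scheme_β_nonneg ℰ hγ.le K
  haveI : IsProbabilityMeasure μ0 :=
    T4GenFunBounds.isProbabilityMeasure_gibbsMeasure (G := Matrix.specialUnitaryGroup (Fin 2) ℂ) (F.P K) hβK
  set θ : GaugeField (F.P K) 0 (Matrix.specialUnitaryGroup (Fin 2) ℂ) → (Fin 3 → ℝ) := fun V μ =>
    (Fintype.card F.USite : ℝ)⁻¹ * ∑ x : F.USite, F.avgObs ℰ K (T3ContinuumYM3Torus.ULoop3.polyakov μ x) V with hθ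
  set fstr : GaugeField (F.P K) 0 (Matrix.specialUnitaryGroup (Fin 2) ℂ) → ℝ := fun V =>
    (os.map fun C => F.avgObs ℰ K C V).prod with hfstr
  set vproj : GaugeField (F.P K) 0 (Matrix.specialUnitaryGroup (Fin 2) ℂ) → ℝ :=
    MeasureTheory.condExp (MeasurableSpace.comap θ MeasurableSpace.pi) μ0 fstr with hvproj
  have hAvg : F.AvgMeasurable ℰ := F.avgMeasurable_of_measurableE ℰ T4ApexTwoLevel.measurableE_expMeanLogSU
  have hθm : Measurable θ := by
    refine measurable_pi_lambda _ fun μ => ?_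
    exact (Finset.measurable_sum _ fun x _ => F.measurable_avgObs hAvg K _).const_mul _
  have hm : MeasurableSpace.comap θ MeasurableSpace.pi ≤
      (inferInstance : MeasurableSpace (GaugeField (F.P K) 0 (Matrix.specialUnitaryGroup (Fin 2) ℂ))) := hθm.comap_le
  have hSM : @StronglyMeasurable _ _ _ (MeasurableSpace.comap θ MeasurableSpace.pi) vproj := stronglyMeasurable_condExp
  have hfbd : ∀ V, |fstr V| ≤ 1 := fun V =>
    abs_prod_map_le_one' (fun C => F.avgObs ℰ K C V) (fun C => F.abs_avgObs_le_one ℰ K C V) os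
  have hfm : Measurable fstr :=
    T4GenFunBounds.measurable_prodObs (F.scheme ℰ γ) (fun K' C => F.measurable_avgObs hAvg K' C) K os
  have hfint : Integrable fstr μ0 :=
    Integrable.mono' (integrable_const (1 : ℝ)) hfm.aestronglyMeasurable
      (ae_of_all _ fun V => by rw [Real.norm_eq_abs]; exact hfbd V)
  have hbd : ∀ᵐ V ∂μ0, |vproj V| ≤ 1 :=
    ae_bdd_abs_condExp_of_ae_bdd_abs (m := MeasurableSpace.comap θ MeasurableSpace.pi) (μ := μ0) (R := (1 : ℝ))
      (f := fstr) (Filter.Eventually.of_forall hfbd)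
  -- Doob–Dynkin: `vproj = φ ∘ θ`
  obtain ⟨φ, hφ, hvφ⟩ := hSM.exists_eq_measurable_comp
  have hφm : Measurable φ := hφ.measurable
  -- `vproj` is twist-invariant a.e., direction by direction; transported: `φ` is flip-invariant a.e. for `ν = θ_* μ0`
  have hflip : ∀ μ' : Fin 3,
      MeasurePreserving (fun v : Fin 3 → ℝ => fun j => if j = μ' then -v j else v j) (μ0.map θ) (μ0.map θ) ∧
      (fun v : Fin 3 → ℝ => φ (fun j => if j = μ' then -v j else v j)) =ᵐ[μ0.map θ] φ := by
    intro μ'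
    obtain ⟨s₀, h₀⟩ := T3ContinuumYM3Torus.exists_ctwist_avgObs F ℰ negOne₂_comm negOne₂_mul_self reTr_negOne₂_mul μ' K
    have hinv : (negOne₂ : Matrix.specialUnitaryGroup (Fin 2) ℂ)⁻¹ = negOne₂ :=
      inv_eq_of_mul_eq_one_right negOne₂_mul_self
    set e : GaugeField (F.P K) 0 (Matrix.specialUnitaryGroup (Fin 2) ℂ) ≃ᵐ
        GaugeField (F.P K) 0 (Matrix.specialUnitaryGroup (Fin 2) ℂ) := GaugeField.ctwistMEquiv negOne₂ μ' s₀ with he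
    have he_apply : ∀ V, e V = GaugeField.ctwist negOne₂ μ' s₀ V := fun V => rfl
    have he2 : ∀ V, e (e V) = V := fun V => by
      rw [he_apply, he_apply]
      have h := GaugeField.ctwist_inv_ctwist (P := F.P K) (j := 0) negOne₂ μ' s₀ V
      rwa [hinv] at h
    have hμe : MeasurePreserving e μ0 μ0 :=
      measurePreserving_ctwist_gibbsMeasure negOne₂_comm (F.P K) ((F.scheme ℰ γ).β K) μ' s₀
    have hfe : ∀ V, fstr (e V) = fstr V := fun V => by
      rw [he_apply]
      show (os.map fun C => F.avgObs ℰ K C (GaugeField.ctwist negOne₂ μ' s₀ V)).prod = (os.map fun C => F.avgObs ℰ K C V).prod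
      simp_rw [h₀]
      rw [prod_map_negOnePow_mul'' (fun C => C.wind μ') (fun C => F.avgObs ℰ K C V) os, (hos μ').neg_one_zpow, one_mul]
    -- the flip of the `μ'`-coordinate
    have hθe : θ ∘ e = (fun v : Fin 3 → ℝ => fun j => if j = μ' then -v j else v j) ∘ θ := by
      funext V j
      simp only [Function.comp_apply, hθ, he_apply]
      have hx : ∀ x : F.USite,
          F.avgObs ℰ K (T3ContinuumYM3Torus.ULoop3.polyakov j x) (GaugeField.ctwist negOne₂ μ' s₀ V) =
            (-1 : ℝ) ^ (if j = μ' then (1 : ℤ) else 0) * F.avgObs ℰ K (T3ContinuumYM3Torus.ULoop3.polyakov j x) V :=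
        fun x => by rw [h₀, wind_polyakov_eq F μ' j x]
      simp_rw [hx]
      rw [← Finset.mul_sum]
      by_cases hj : j = μ'
      · rw [if_pos hj, if_pos hj]; ring
      · rw [if_neg hj, if_neg hj]; ring
    have hFm : Measurable (fun v : Fin 3 → ℝ => fun j => if j = μ' then -v j else v j) :=
      measurable_pi_lambda _ fun j => by
        by_cases hj : j = μ'
        · simp only [hj, if_true]; exact (measurable_pi_apply μ').neg
        · simp only [hj, if_false]; exact measurable_pi_apply j
    have hem : Measurable[MeasurableSpace.comap θ MeasurableSpace.pi, MeasurableSpace.comap θ MeasurableSpace.pi] e := by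
      rw [measurable_iff_comap_le, MeasurableSpace.comap_comp, hθe, ← MeasurableSpace.comap_comp]
      exact MeasurableSpace.comap_mono hFm.comap_le
    have key := condExp_comp_ae_eq_of_measurePreserving (μ := μ0) hm e hμe hem he2 hfint hfe
    refine ⟨⟨hFm, ?_⟩, ?_⟩
    · rw [Measure.map_map hFm hθm, ← hθe, ← Measure.map_map hθm e.measurable, hμe.map_eq]
    · show ∀ᵐ x ∂(μ0.map θ), φ (fun j => if j = μ' then -x j else x j) = φ x
      refine (ae_map_iff hθm.aemeasurable (measurableSet_eq_fun (hφm.comp hFm) hφm)).2 ?_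
      filter_upwards [key] with V hV
      show φ ((fun v : Fin 3 → ℝ => fun j => if j = μ' then -v j else v j) (θ V)) = φ (θ V)
      have h1 : (fun v : Fin 3 → ℝ => fun j => if j = μ' then -v j else v j) (θ V) = θ (e V) := by
        have := congrFun hθe V
        simp only [Function.comp_apply] at this
        exact this.symm
      rw [h1]
      have h2 : φ (θ (e V)) = vproj (e V) := by rw [hvφ]; rfl
      have h3 : φ (θ V) = vproj V := by rw [hvφ]; rfl
      rw [h2, h3]
      exact hV
  -- hence `vproj` is a.e. the `σ(|θ|)`-measurable function `w := (φ ∘ |·|) ∘ θ`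
  have habs := ae_eq_comp_abs_of_flip_invariant (fun i => (hflip i).1) (fun i => (hflip i).2)
  set w : GaugeField (F.P K) 0 (Matrix.specialUnitaryGroup (Fin 2) ℂ) → ℝ := fun V => φ (fun j => |θ V j|) with hw
  have hwv : w =ᵐ[μ0] vproj := by
    have h := ae_eq_comp hθm.aemeasurable habs
    rw [hvφ]
    exact h
  have habsm : Measurable (fun v : Fin 3 → ℝ => fun j => |v j|) := measurable_pi_lambda _ fun j => (measurable_pi_apply j).abs
  have hwm : Measurable w := hφm.comp (habsm.comp hθm)
  have hθabs : (fun (V : GaugeField (F.P K) 0 (Matrix.specialUnitaryGroup (Fin 2) ℂ)) (μ : Fin 3) => |θ V μ|) =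
      (fun v : Fin 3 → ℝ => fun j => |v j|) ∘ θ := rfl
  have hwSM : @StronglyMeasurable _ _ _ (MeasurableSpace.comap (fun (V : GaugeField (F.P K) 0
      (Matrix.specialUnitaryGroup (Fin 2) ℂ)) (μ : Fin 3) => |θ V μ|) MeasurableSpace.pi) w := by
    have hmeas : Measurable[MeasurableSpace.comap (fun (V : GaugeField (F.P K) 0
        (Matrix.specialUnitaryGroup (Fin 2) ℂ)) (μ : Fin 3) => |θ V μ|) MeasurableSpace.pi]
        (fun (V : GaugeField (F.P K) 0 (Matrix.specialUnitaryGroup (Fin 2) ℂ)) (μ : Fin 3) => |θ V μ|) :=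
      measurable_iff_comap_le.2 le_rfl
    exact (hφ.comp_measurable hmeas)
  have hwbd : ∀ᵐ V ∂μ0, |w V| ≤ 1 := by
    filter_upwards [hwv, hbd] with V hV hb
    rw [hV]; exact hb
  have hwint : ∫ V, w V ∂μ0 = (F.scheme ℰ γ).expectAt K os := by
    rw [integral_congr_ae hwv, hvproj, integral_condExp hm]
    exact (T4GenFunBounds.expectAt_eq_integral_gibbs _ (F.scheme_β_nonneg ℰ hγ.le) K os).symm
  -- the two stubs
  have h1' := hK₁ K (le_of_max_le_left hK) Ω mΩ P hP W hW U hU0 hUsol T hTpos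
  have h2' := hK₂ K (le_of_max_le_right hK) w (by simpa only [hθ] using hwSM) hwbd Ω mΩ P hP W hW U hU0 hUsol T hT₀le
  rw [hwint] at h2'
  -- along the flow `w = vproj` for every positive time (law ≪ Haar ≪ Gibbs)
  have hflow : ∀ s : ℝ, 0 < s →
      ∫ ω, w (fun b : PBond (F.P K) 0 => U (s / (F.P K).eps).toNNReal ω (b.src, b.dir)) ∂P =
        ∫ ω, vproj (fun b : PBond (F.P K) 0 => U (s / (F.P K).eps).toNNReal ω (b.src, b.dir)) ∂P := by
    intro s hs
    have hspos : 0 < (s / (F.P K).eps).toNNReal := Real.toNNReal_pos.2 (div_pos hs (F.P K).eps_pos)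
    have hac := stub_langevinLawAbsCont F γ hγ K Ω mΩ P hP W hW U hU0 hUsol _ hspos
    have hac' : P.map (fun ω => fun b : PBond (F.P K) 0 => U (s / (F.P K).eps).toNNReal ω (b.src, b.dir)) ≪ μ0 :=
      hac.trans (fieldMeasure_absolutelyContinuous_gibbsMeasure (F.P K) ((F.scheme ℰ γ).β K))
    have hUm : Measurable (U (s / (F.P K).eps).toNNReal) := (hUsol.adapted _).mono (hW.natFiltration.le _) le_rfl
    have hΦ : Measurable fun ω => (fun b : PBond (F.P K) 0 => U (s / (F.P K).eps).toNNReal ω (b.src, b.dir) :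
        GaugeField (F.P K) 0 (Matrix.specialUnitaryGroup (Fin 2) ℂ)) :=
      (measurable_pi_lambda _ fun b => measurable_pi_apply _).comp hUm
    have hae := ae_eq_comp' hΦ.aemeasurable hwv hac'
    exact integral_congr_ae hae
  set Ih : ℝ := intervalIntegral (fun s : ℝ => MeasureTheory.integral P (fun ω =>
      vproj (fun b : PBond (F.P K) 0 => U (s / (F.P K).eps).toNNReal ω (b.src, b.dir)))) 0 T volume with hIh
  set Iw : ℝ := intervalIntegral (fun s : ℝ => MeasureTheory.integral P (fun ω =>
      w (fun b : PBond (F.P K) 0 => U (s / (F.P K).eps).toNNReal ω (b.src, b.dir)))) 0 T volume with hIw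
  set If : ℝ := intervalIntegral (fun s : ℝ => MeasureTheory.integral P (fun ω =>
      (os.map fun C => F.avgObs ℰ K C (fun b : PBond (F.P K) 0 => U (s / (F.P K).eps).toNNReal ω (b.src, b.dir))).prod))
      0 T volume with hIf
  have hIwh : Iw = Ih := by
    rw [hIw, hIh]
    refine intervalIntegral.integral_congr_ae (ae_of_all _ fun s hs => ?_)
    rw [Set.uIoc_of_le hTpos.le] at hs
    exact hflow s hs.1
  rw [hIwh] at h2'
  have hTinv : 0 < T⁻¹ := inv_pos.mpr hTpos
  have hthird : |T⁻¹ * Ih - T⁻¹ * If| ≤ δ / 3 + c / T := by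
    rw [← mul_sub, abs_mul, abs_of_pos hTinv]
    calc T⁻¹ * |Ih - If| ≤ T⁻¹ * (δ / 3 * T + c) := by gcongr
      _ = δ / 3 + c / T := by field_simp
  calc |(F.scheme ℰ γ).expectAt K os - T⁻¹ * If|
      ≤ |(F.scheme ℰ γ).expectAt K os - T⁻¹ * Ih| + |T⁻¹ * Ih - T⁻¹ * If| := abs_sub_le _ _ _
    _ ≤ δ / 3 + (δ / 3 + c / T) := add_le_add h2' hthird
    _ ≤ δ := by linarith

end Summit.QuantumFields.YangMills.Theorems.ColdStartUniversality

end
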